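import Summits.FinalStateConjecture.FinalStateConjecture.Statement
import Summits.FinalStateConjecture.FinalStateConjecture.Theorems.TameCensorship.Negative.GenericityModel
import Literature.Geometry.Lorentzian.FinalState
import Literature.Geometry.Lorentzian.Genericity
import Literature.Geometry.Lorentzian.HypersurfaceConstraints
import Literature.Geometry.Lorentzian.DataEmbeddingNormalSmooth
import Literature.Geometry.Lorentzian.MetricValCongr
import Literature.Geometry.Lorentzian.LeviCivitaProofs
import Literature.Geometry.Lorentzian.IsometryProofs
import Literature.Geometry.Lorentzian.TrivialDataAdmissible
import Literature.Geometry.Lorentzian.CoordFamilyRegularity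
import Literature.Geometry.Lorentzian.ChartMetricCoord
import Literature.Geometry.Lorentzian.PseudoRiemannianMetricProofs

/-!
# `WeakCosmicCensorshipMGHD` (crux `stmt-FinalStateConjecture-9952`), negative-side support I:
# the Hamiltonian constraint is forced by a vacuum data embedding (Gauss), and it is jointly
# continuous along smooth families of data on `ℝ³`

Support file of the crux disprover (cdisprove seat, cycle 2), `sorry`-free, no named facts; the
two analytic inputs of `ConstraintsLoadBearing.lean` (the vacuum-constraint clause of
admissibility is load-bearing for the crux):

* §1 (Gauss) `hamiltonianConstraintFn_eq_zero_of_dataEmbedding`: a datum carried by a data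
  embedding into a Ricci-flat spacetime satisfies the Hamiltonian constraint
  `R(h) − |k|² + (tr k)² = 0` (twice-traced Gauss equation of the tree,
  `scalarCurvature_inducedMetric_sub_normSq_add_sq_eq_zero`, the future unit normal being smooth
  along the embedding, `DataEmbedding.contMDiffAt_embed_normal`; transport from `(ι^* g, K_ν)` to
  `(h, k)` by `induced_h`, `induced_k` and the value-congruence lemmas of `MetricValCongr`); hence
  a datum violating it at one point has NO vacuum Cauchy development
  (`isEmpty_vacuumCauchyDevelopment_of_hamiltonianConstraintFn_ne_zero`): it is exceptional for
  the crux's property under every Levi-Civita instance.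
* §2 (continuity) `continuous_hamiltonianConstraintFn_family`: along a smooth one-parameter family
  of data on `ℝ³` (`InitialDataSet.IsSmoothDataFamily 1`: joint `C^∞` on `ℝ¹ × Σ` of `h` and `k`
  as bundle sections, unpacked by `contDiffAt_h_family` / `contDiffAt_k_family`) the Hamiltonian
  constraint function is jointly continuous in `(point, parameter)` — coordinate calculus of the
  tree (`OpensChart.scalarCurvature_eq_scalAt`, `trace_eq_mtrAt`, `normSq_eq_normSqAt`) and the
  Ricci-flow regularity bricks `MetricCoord.IsMetricFamilyOn.contDiffOn_*_family`; the scalar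
  curvature part follows the pattern of `ParametricKerrBurial/Negative/ZeroSpinBurialLimit`.

## References

* Y. Choquet-Bruhat, *General Relativity and the Einstein Equations* (2009), Ch. VI, Thm. 3.3.
* B. O'Neill, *Semi-Riemannian geometry* (1983), Ch. 4, Thm. 5 and Corollary; Ch. 3, Def. 3.53.
* D. Christodoulou, CQG 16 (1999) A23, p. A24 (families of data).
* P. Topping, *Lectures on the Ricci flow* (2006), §1.2.3.
-/

noncomputable section

-- instance search through nested operator types (as in the tree's coordinate-calculus files)
set_option maxSynthPendingDepth 3

open Bundle TopologicalSpace Manifold Set Function Filter Metric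
open scoped ContDiff Topology InnerProductSpace RealInnerProductSpace

namespace Summit.FinalStateConjecture.FinalStateConjecture.Theorems.WeakCosmicCensorshipMGHD.Negative

open Literature.Geometry.Lorentzian
open Summit.FinalStateConjecture.FinalStateConjecture.Theorems.TameCensorship.Negative

/-! ## §1 Gauss: data with a vacuum data embedding satisfy the Hamiltonian constraint -/

section MetricCongr

variable {E : Type*} [NormedAddCommGroup E] [NormedSpace ℝ E] {H : Type*} [TopologicalSpace H]
  {I : ModelWithCorners ℝ E H} {M : Type*} [TopologicalSpace M] [ChartedSpace H M]
  [IsManifold I ∞ M] {n₁ n₂ : WithTop ℕ∞}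
  {g₁ : PseudoRiemannianMetric I n₁ E (TangentSpace I : M → Type _)}
  {g₂ : PseudoRiemannianMetric I n₂ E (TangentSpace I : M → Type _)}
  [FiniteDimensional ℝ E]

/-- The metric square norm of a bilinear form only depends on the scalar product on the fibre
(companion of the tree's `PseudoRiemannianMetric.trace_congr_of_val_eq'`).
[cite: ONeill1983, Ch. 3, pp. 60–61] -/
theorem normSq_congr_of_val_eq {x : M} (h : g₁.val x = g₂.val x)
    (T : LinearMap.BilinForm ℝ (TangentSpace I x)) : g₁.normSq x T = g₂.normSq x T := by
  haveI : FiniteDimensional ℝ (TangentSpace I x) := ‹FiniteDimensional ℝ E›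
  let F : (B : LinearMap.BilinForm ℝ (TangentSpace I x)) → B.Nondegenerate → ℝ := fun B hB ↦
    LinearMap.trace ℝ (TangentSpace I x)
      (((B.toDual hB).symm.toLinearMap ∘ₗ T) ∘ₗ ((B.toDual hB).symm.toLinearMap ∘ₗ T.flip))
  have hF : ∀ (B₁ B₂ : LinearMap.BilinForm ℝ (TangentSpace I x)) (p₁ : B₁.Nondegenerate)
      (p₂ : B₂.Nondegenerate), B₁ = B₂ → F B₁ p₁ = F B₂ p₂ := by
    rintro B₁ _ p₁ p₂ rfl
    rfl
  have hB : (g₁.toBilinForm x : LinearMap.BilinForm ℝ (TangentSpace I x)) = g₂.toBilinForm x :=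
    congrArg (fun X : TangentSpace I x →L[ℝ] TangentSpace I x →L[ℝ] ℝ ↦
      (X.toLinearMap₁₂ : LinearMap.BilinForm ℝ (TangentSpace I x))) h
  exact hF (g₁.toBilinForm x) (g₂.toBilinForm x) (g₁.nondegenerate_toBilinForm x)
    (g₂.nondegenerate_toBilinForm x) hB

end MetricCongr

section Gauss

variable {X : Type} [TopologicalSpace X] [ChartedSpace E3 X] [IsManifold (𝓡 3) ∞ X]
  [ConnectedSpace X] {D : InitialDataSet (𝓡 3) X}

/-- A data embedding is a spacelike immersion: `ι` is smooth and `ι^* g = h` is positive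
definite (`induced_h`). [cite: ONeill1983, Ch. 4, p. 97] -/
theorem isSpacelikeImmersion_dataEmbedding (𝒮 : DataEmbedding D) :
    𝒮.metric.toPseudoRiemannianMetric.IsSpacelikeImmersion (𝓡 3) 𝒮.embed := by
  refine ⟨𝒮.isSmoothEmbedding.contMDiff.of_le (le_of_eq rfl), fun y v hv ↦ ?_⟩
  have h := 𝒮.induced_h y
  have h' : 𝒮.metric.toPseudoRiemannianMetric.inducedBilin (𝓡 3) 𝒮.embed y v v =
      D.h.inner y v v := by
    show pullbackBilin (I := 𝓡 4) (I' := 𝓡 3) 𝒮.embed 𝒮.metric.val y v v = D.h.inner y v v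
    rw [h]
  rw [h']
  exact D.h.pos y v hv

/-- The induced metric `ι^* g` of a data embedding has the values of the data metric `h`.
[cite: ChoquetBruhatGeroch1969CMP, p. 330] -/
theorem inducedMetric_dataEmbedding_val_eq (𝒮 : DataEmbedding D)
    (hfi : 𝒮.metric.toPseudoRiemannianMetric.IsSpacelikeImmersion (𝓡 3) 𝒮.embed) (y : X) :
    (𝒮.metric.toPseudoRiemannianMetric.inducedMetric 𝒮.embed
      PseudoRiemannianMetric.contMDiff_pullbackBilin_holds hfi).val y = D.metric.val y := by
  rw [PseudoRiemannianMetric.inducedMetric_val, InitialDataSet.val_metric]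
  exact 𝒮.induced_h y

/-- **Gauss.** A datum carried by a data embedding into a Ricci-flat spacetime satisfies the
Hamiltonian constraint `R(h) − |k|²_h + (tr_h k)² = 0` at every point: the twice-traced Gauss
equation of the tree (`scalarCurvature_inducedMetric_sub_normSq_add_sq_eq_zero`, with the future
unit normal of the embedding, smooth by `DataEmbedding.contMDiffAt_embed_normal`), transported from
`(ι^* g, K_ν)` to `(h, k)` through `induced_h`, `induced_k`.
[cite: ChoquetBruhat2009, Ch. VI, Thm. 3.3] -/
theorem hamiltonianConstraintFn_eq_zero_of_dataEmbedding (𝒮 : DataEmbedding D)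
    [𝒮.metric.toPseudoRiemannianMetric.HasLeviCivita] [D.metric.HasLeviCivita]
    (hvac : 𝒮.metric.toPseudoRiemannianMetric.IsRicciFlat) (y : X) :
    D.hamiltonianConstraintFn y = 0 := by
  set g := 𝒮.metric.toPseudoRiemannianMetric with hg
  have hfi : g.IsSpacelikeImmersion (𝓡 3) 𝒮.embed := isSpacelikeImmersion_dataEmbedding 𝒮
  have hun : g.IsUnitNormal (𝓡 3) 𝒮.embed 𝒮.normal (-1) := 𝒮.isFutureUnitNormal.1
  have hνs : ContMDiff (𝓡 3) (𝓡 4).tangent ∞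
      (fun x ↦ (TotalSpace.mk' E4 (𝒮.embed x) (𝒮.normal x) : TangentBundle (𝓡 4) 𝒮.carrier)) :=
    fun x ↦ 𝒮.contMDiffAt_embed_normal x
  haveI := (g.inducedMetric 𝒮.embed PseudoRiemannianMetric.contMDiff_pullbackBilin_holds
    hfi).hasLeviCivita
  have hm : Module.finrank ℝ E3 = 3 := finrank_euclideanSpace_fin
  have hm1 : Module.finrank ℝ E4 = 3 + 1 := finrank_euclideanSpace_fin
  have hG := PseudoRiemannianMetric.scalarCurvature_inducedMetric_sub_normSq_add_sq_eq_zero g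
    PseudoRiemannianMetric.contMDiff_pullbackBilin_holds hfi hνs hun hm hm1 y (hvac _)
  have hval : ∀ y, (g.inducedMetric 𝒮.embed PseudoRiemannianMetric.contMDiff_pullbackBilin_holds
      hfi).val y = D.metric.val y := inducedMetric_dataEmbedding_val_eq 𝒮 hfi
  have hK : g.secondFundamentalForm (𝓡 3) 𝒮.embed 𝒮.normal y = D.kBilin y := 𝒮.induced_k y
  rw [InitialDataSet.hamiltonianConstraintFn, InitialDataSet.traceK, InitialDataSet.normSqK,
    ← PseudoRiemannianMetric.scalarCurvature_congr_of_val_eq hval y,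
    ← PseudoRiemannianMetric.trace_congr_of_val_eq' (hval y),
    ← normSq_congr_of_val_eq (hval y), ← hK]
  exact hG

/-- **A datum violating the Hamiltonian constraint at one point has no vacuum Cauchy
development** (under any Levi-Civita instance of its metric). [cite: ChoquetBruhat2009, Ch. VI, Thm. 3.3] -/
theorem isEmpty_vacuumCauchyDevelopment_of_hamiltonianConstraintFn_ne_zero
    [D.metric.HasLeviCivita] {y : X} (h : D.hamiltonianConstraintFn y ≠ 0) :
    IsEmpty (VacuumCauchyDevelopment D) :=
  ⟨fun 𝒟 ↦ by
    haveI := 𝒟.metric.toPseudoRiemannianMetric.hasLeviCivita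
    exact h (hamiltonianConstraintFn_eq_zero_of_dataEmbedding 𝒟.toDataEmbedding 𝒟.isRicciFlat y)⟩

/-- The same under the CANONICAL Levi-Civita instance of the data metric, with no instance
argument (the form in which the continuity statement of §2 delivers the hypothesis). -/
theorem isEmpty_vacuumCauchyDevelopment_of_ne_zero {y : X}
    (h : (haveI := D.metric.hasLeviCivita; D.hamiltonianConstraintFn y) ≠ 0) :
    IsEmpty (VacuumCauchyDevelopment D) := by
  haveI := D.metric.hasLeviCivita
  exact isEmpty_vacuumCauchyDevelopment_of_hamiltonianConstraintFn_ne_zero h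

end Gauss

/-! ## §2 The Hamiltonian constraint function is jointly continuous along smooth families on `ℝ³` -/

section Family

/-- Joint smoothness in a chart: a `C^∞` map on the manifold `ℝ¹ × U` (`U` open in `E3`) into a
normed space is, through the identity chart, jointly `C^∞` in `(c, y)` on `ℝ¹ × E3` near every
point of `ℝ¹ × U` (composition with a local inverse of `Subtype.val`; pattern of
`ParametricKerrBurial/Negative/ZeroSpinBurialLimit.contDiffAt_repr_of_isSmoothDataFamily`). -/
theorem contDiffAt_uncurry_of_contMDiffAt {U : Opens E3} {V : Type*} [NormedAddCommGroup V]
    [NormedSpace ℝ V] {Φ : EuclideanSpace ℝ (Fin 1) → E3 → V} {c₀ : EuclideanSpace ℝ (Fin 1)}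
    {y₀ : U}
    (h : ContMDiffAt (𝓘(ℝ, EuclideanSpace ℝ (Fin 1)).prod 𝓘(ℝ, E3)) 𝓘(ℝ, V) ∞
      (fun x : EuclideanSpace ℝ (Fin 1) × U ↦ Φ x.1 x.2) (c₀, y₀)) :
    ContDiffAt ℝ ∞ (Function.uncurry Φ) (c₀, (y₀ : E3)) := by
  classical
  set σ : E3 → U := fun z ↦ if hz : z ∈ U then ⟨z, hz⟩ else y₀ with hσdef
  have hσval : ∀ z ∈ (U : Set E3), (σ z : E3) = z := fun z hz ↦ by
    have hz' : z ∈ U := hz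
    simp only [hσdef]
    rw [dif_pos hz']
  have hσy₀ : σ y₀ = y₀ := by
    simp only [hσdef]
    rw [dif_pos y₀.2]
  have hUo : IsOpen ((Set.univ : Set (EuclideanSpace ℝ (Fin 1))) ×ˢ (U : Set E3)) :=
    isOpen_univ.prod U.2
  have hmem : (c₀, (y₀ : E3)) ∈ (Set.univ : Set (EuclideanSpace ℝ (Fin 1))) ×ˢ (U : Set E3) :=
    ⟨trivial, y₀.2⟩
  have hj2 : ContMDiffAt 𝓘(ℝ, EuclideanSpace ℝ (Fin 1) × E3) 𝓘(ℝ, E3) ∞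
      (fun q : EuclideanSpace ℝ (Fin 1) × E3 ↦ σ q.2) (c₀, (y₀ : E3)) := by
    rw [← ContMDiffAt.subtypeVal_comp_iff]
    have hev : (Subtype.val ∘ fun q : EuclideanSpace ℝ (Fin 1) × E3 ↦ σ q.2) =ᶠ[𝓝 (c₀, (y₀ : E3))]
        Prod.snd := by
      filter_upwards [hUo.mem_nhds hmem] with q hq
      exact hσval q.2 hq.2
    exact contDiff_snd.contMDiff.contMDiffAt.congr_of_eventuallyEq hev
  have hj : ContMDiffAt 𝓘(ℝ, EuclideanSpace ℝ (Fin 1) × E3)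
      (𝓘(ℝ, EuclideanSpace ℝ (Fin 1)).prod 𝓘(ℝ, E3)) ∞
      (fun q : EuclideanSpace ℝ (Fin 1) × E3 ↦ (q.1, σ q.2)) (c₀, (y₀ : E3)) :=
    contDiff_fst.contMDiff.contMDiffAt.prodMk hj2
  have hcomp : ContMDiffAt 𝓘(ℝ, EuclideanSpace ℝ (Fin 1) × E3) 𝓘(ℝ, V) ∞
      ((fun x : EuclideanSpace ℝ (Fin 1) × U ↦ Φ x.1 x.2) ∘
        fun q : EuclideanSpace ℝ (Fin 1) × E3 ↦ (q.1, σ q.2)) (c₀, (y₀ : E3)) :=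
    ContMDiffAt.comp_of_eq h hj (Prod.ext rfl hσy₀)
  have hev2 : Function.uncurry Φ =ᶠ[𝓝 (c₀, (y₀ : E3))]
      ((fun x : EuclideanSpace ℝ (Fin 1) × U ↦ Φ x.1 x.2) ∘
        fun q : EuclideanSpace ℝ (Fin 1) × E3 ↦ (q.1, σ q.2)) := by
    filter_upwards [hUo.mem_nhds hmem] with q hq
    simp only [Function.comp_apply, Function.uncurry, hσval q.2 hq.2]
  exact contMDiffAt_iff_contDiffAt.1 (hcomp.congr_of_eventuallyEq hev2)

variable {F : EuclideanSpace ℝ (Fin 1) → SliceData}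

/-- **The typed family smoothness unpacked, metric part**: along a smooth one-parameter family
of data on `ℝ³`, `(c, y) ↦ h_c(y)` is jointly `C^∞` as a map `ℝ¹ × E3 → Bil`.
[cite: Christodoulou1999, p. A24] -/
theorem contDiffAt_h_family (hF : InitialDataSet.IsSmoothDataFamily 1 F)
    (c₀ : EuclideanSpace ℝ (Fin 1)) (y₀ : Minkowski.slice) :
    ContDiffAt ℝ ∞
      (Function.uncurry fun (c : EuclideanSpace ℝ (Fin 1)) (z : E3) ↦
        toBil ((F c).h.inner ⟨z, Minkowski.mem_slice z⟩)) (c₀, (y₀ : E3)) := by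
  refine contDiffAt_uncurry_of_contMDiffAt (U := Minkowski.slice) ?_
  have h := (contMDiffAt_totalSpace_bilin_iff Minkowski.slice Prod.snd
    (fun x : EuclideanSpace ℝ (Fin 1) × Minkowski.slice ↦ toBil ((F x.1).h.inner x.2)) (c₀, y₀)).1
    (hF.1 (c₀, y₀))
  exact h.2

/-- **The typed family smoothness unpacked, `k` part**: `(c, y) ↦ k_c(y)` is jointly `C^∞`.
[cite: Christodoulou1999, p. A24] -/
theorem contDiffAt_k_family (hF : InitialDataSet.IsSmoothDataFamily 1 F)
    (c₀ : EuclideanSpace ℝ (Fin 1)) (y₀ : Minkowski.slice) :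
    ContDiffAt ℝ ∞
      (Function.uncurry fun (c : EuclideanSpace ℝ (Fin 1)) (z : E3) ↦
        kBil (F c) ⟨z, Minkowski.mem_slice z⟩) (c₀, (y₀ : E3)) := by
  refine contDiffAt_uncurry_of_contMDiffAt (U := Minkowski.slice) ?_
  have h := (contMDiffAt_totalSpace_bilin_iff Minkowski.slice Prod.snd
    (fun x : EuclideanSpace ℝ (Fin 1) × Minkowski.slice ↦ kBil (F x.1) x.2) (c₀, y₀)).1
    (hF.2 (c₀, y₀))
  exact h.2

/-- The line `t ↦ t e₁` composed with a jointly smooth map: `(z, t) ↦ Φ (t e₁) z` is `C^∞`. -/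
theorem contDiff_family_line {V : Type*} [NormedAddCommGroup V] [NormedSpace ℝ V]
    {Φ : EuclideanSpace ℝ (Fin 1) → E3 → V}
    (h : ∀ c (z : E3), ContDiffAt ℝ ∞ (Function.uncurry Φ) (c, z)) :
    ContDiff ℝ ∞ fun q : E3 × ℝ ↦ Φ (q.2 • EuclideanSpace.single (0 : Fin 1) (1 : ℝ)) q.1 := by
  rw [contDiff_iff_contDiffAt]
  intro p
  have hB : ContDiffAt ℝ ∞
      (fun q : E3 × ℝ ↦ (q.2 • EuclideanSpace.single (0 : Fin 1) (1 : ℝ), q.1)) p :=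
    ((contDiff_snd.smul contDiff_const).prodMk contDiff_fst).contDiffAt
  exact (h _ _).comp p hB

/-- Along a smooth family of data on `ℝ³` the metric components form a smooth metric family in
coordinates (`MetricCoord.IsMetricFamilyOn`, along the line `t ↦ t e₁`; pattern of
`ZeroSpinBurialLimit.isMetricFamilyOn_of_isSmoothDataFamily`). [cite: Christodoulou1999, p. A24] -/
theorem isMetricFamilyOn_family (hF : InitialDataSet.IsSmoothDataFamily 1 F) :
    MetricCoord.IsMetricFamilyOn
      (fun (t : ℝ) (z : E3) ↦ toBil ((F (t • EuclideanSpace.single (0 : Fin 1) (1 : ℝ))).h.inner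
        ⟨z, Minkowski.mem_slice z⟩)) Set.univ ((Minkowski.slice : Opens E3) : Set E3) where
  isMetricOn t _ :=
    OpensChart.isMetricOn_repr
      (g := (F (t • EuclideanSpace.single (0 : Fin 1) (1 : ℝ))).metric)
      (G := fun z : E3 ↦ toBil ((F (t • EuclideanSpace.single (0 : Fin 1) (1 : ℝ))).h.inner
        ⟨z, Minkowski.mem_slice z⟩)) fun y ↦ by
      rw [InitialDataSet.val_metric]; rfl
  contDiffOn := (contDiff_family_line fun c z ↦
    contDiffAt_h_family hF c ⟨z, Minkowski.mem_slice z⟩).contDiffOn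
  uniqueDiffOn := uniqueDiffOn_univ
  subset_closure_interior := by simp

/-- Coordinate regularity of the metric square norm along a metric family (companion of the
tree's `IsMetricFamilyOn.contDiffOn_mtrAt_family`). [cite: Topping2006, §1.2.3] -/
theorem contDiffOn_normSqAt_family {G : ℝ → E3 → Bil} {S : Set ℝ} {V : Set E3}
    (hG : MetricCoord.IsMetricFamilyOn G S V) {β : E3 × ℝ → Bil}
    (hβ : ContDiffOn ℝ ∞ β (V ×ˢ S)) :
    ContDiffOn ℝ ∞ (fun q : E3 × ℝ ↦ MetricCoord.normSqAt (G q.2) q.1 (β q)) (V ×ˢ S) := by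
  simp only [MetricCoord.normSqAt_eq_traceCLM]
  have hflip : ContDiffOn ℝ ∞ (fun q ↦ (β q).flip) (V ×ˢ S) :=
    (ContinuousLinearMap.flipₗᵢ ℝ E3 E3 ℝ).contDiff.comp_contDiffOn hβ
  exact (MetricCoord.traceCLM E3).contDiff.comp_contDiffOn
    ((hG.contDiffOn_sharpAt_family.clm_comp hβ).clm_comp
      (hG.contDiffOn_sharpAt_family.clm_comp hflip))

/-- **The Hamiltonian constraint function in coordinates** for a datum on `ℝ³`:
`R(h) − |k|² + (tr k)² = scalAt G − normSqAt G k + (mtrAt G k)²` for a representative `G` of the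
metric (`h_y = G y`). [cite: ONeill1983, Ch. 3, Def. 3.53] -/
theorem hamiltonianConstraintFn_eq_coord (D : SliceData) [D.metric.HasLeviCivita] {G : E3 → Bil}
    (hG : ∀ y : Minkowski.slice, D.metric.val y = G y) (x : Minkowski.slice) :
    D.hamiltonianConstraintFn x =
      MetricCoord.scalAt G x - MetricCoord.normSqAt G x (kBil D x) +
        MetricCoord.mtrAt G x (kBil D x) ^ 2 := by
  rw [InitialDataSet.hamiltonianConstraintFn, InitialDataSet.traceK, InitialDataSet.normSqK,
    OpensChart.scalarCurvature_eq_scalAt hG x,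
    OpensChart.normSq_eq_normSqAt hG x (D.kBilin x) (kBil D x) (fun v w ↦ rfl),
    OpensChart.trace_eq_mtrAt hG x (D.kBilin x) (kBil D x) (fun v w ↦ rfl)]

/-- **The Hamiltonian constraint function is jointly continuous along a smooth family of data on
`ℝ³`**: `(z, t) ↦ (R(h) − |k|² + (tr k)²)[F (t e₁)](z)` is continuous on `E3 × ℝ` (each member
with its canonical Levi-Civita instance). [cite: Christodoulou1999, p. A24] [cite: ONeill1983, Ch. 3, Def. 3.53] -/
theorem continuous_hamiltonianConstraintFn_family (hF : InitialDataSet.IsSmoothDataFamily 1 F) :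
    Continuous fun q : E3 × ℝ ↦
      haveI := (F (q.2 • EuclideanSpace.single (0 : Fin 1) (1 : ℝ))).metric.hasLeviCivita
      (F (q.2 • EuclideanSpace.single (0 : Fin 1) (1 : ℝ))).hamiltonianConstraintFn
        ⟨q.1, Minkowski.mem_slice q.1⟩ := by
  set G : ℝ → E3 → Bil := fun t z ↦
    toBil ((F (t • EuclideanSpace.single (0 : Fin 1) (1 : ℝ))).h.inner ⟨z, Minkowski.mem_slice z⟩)
    with hGdef
  set β : E3 × ℝ → Bil := fun q ↦
    kBil (F (q.2 • EuclideanSpace.single (0 : Fin 1) (1 : ℝ))) ⟨q.1, Minkowski.mem_slice q.1⟩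
    with hβdef
  have hfam : MetricCoord.IsMetricFamilyOn G Set.univ ((Minkowski.slice : Opens E3) : Set E3) :=
    isMetricFamilyOn_family hF
  have huniv : ((Minkowski.slice : Opens E3) : Set E3) ×ˢ (Set.univ : Set ℝ) = Set.univ := by
    ext q; simp [Minkowski.mem_slice]
  have hβ : ContDiffOn ℝ ∞ β (((Minkowski.slice : Opens E3) : Set E3) ×ˢ (Set.univ : Set ℝ)) :=
    (contDiff_family_line fun c z ↦ contDiffAt_k_family hF c ⟨z, Minkowski.mem_slice z⟩).contDiffOn
  have hcont : Continuous fun q : E3 × ℝ ↦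
      MetricCoord.scalAt (G q.2) q.1 - MetricCoord.normSqAt (G q.2) q.1 (β q) +
        MetricCoord.mtrAt (G q.2) q.1 (β q) ^ 2 := by
    have h1 := hfam.contDiffOn_scalAt_family.continuousOn
    have h2 := (contDiffOn_normSqAt_family hfam hβ).continuousOn
    have h3 := (hfam.contDiffOn_mtrAt_family hβ).continuousOn
    rw [huniv] at h1 h2 h3
    exact continuousOn_univ.1 ((h1.sub h2).add (h3.pow 2))
  refine hcont.congr fun q ↦ ?_
  haveI := (F (q.2 • EuclideanSpace.single (0 : Fin 1) (1 : ℝ))).metric.hasLeviCivita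
  exact (hamiltonianConstraintFn_eq_coord (F (q.2 • EuclideanSpace.single (0 : Fin 1) (1 : ℝ)))
    (G := G q.2) (fun y ↦ by rw [InitialDataSet.val_metric]; rfl) ⟨q.1, Minkowski.mem_slice q.1⟩).symm

end Family

end Summit.FinalStateConjecture.FinalStateConjecture.Theorems.WeakCosmicCensorshipMGHD.Negative

end
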